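import Mathlib.MeasureTheory.Integral.IntervalIntegral.Basic
import Mathlib.Analysis.SpecialFunctions.Trigonometric.Basic
import Mathlib.Analysis.SpecialFunctions.Exponential
import Mathlib.Analysis.SpecialFunctions.Complex.Circle
import Mathlib.Analysis.SpecialFunctions.Integrals.Basic
import Mathlib.Algebra.Field.GeomSum
import Mathlib.Tactic
import HarnessLib

/-!
# Exponential moments and large deviations of `S_L(x) = ∑_{j<L} cos(2π 2^j x)` (Pintz–Ruzsa I, §4, §7)

Topic `Literature/NumberTheory/Sieve` (additive problems with primes and powers of `2`). Everything in
this file is PROVED; there are no named facts, and no numerical value is asserted.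

J. Pintz, I. Z. Ruzsa, *On Linnik's approximation to Goldbach's problem, I*, Acta Arith. 109 (2003),
§3–§4 and §7: the measure of the set where the generating function of the powers of `2`,
`G_L(x) = ∑_{j<L} e(2^j x)` (`g = 2`), is large is controlled through the exponential moments of
`S_L(x) = Re G_L(x) = ∑_{j<L} cos(2π 2^j x)`,

  `E_L(ξ) = ∫₀¹ e^{ξ S_L(x)} dx`,  `E*_M(ξ) = 2^{-M} ∑_{k<2^M} e^{ξ S_M(k 2^{-M})}`.

Theorem 2(b) there: for `ξ ≥ 0` and every `L`, `E_L(ξ) ≤ e^{Lψ(ξ)} ≤ E*_L(ξ)`, proved through the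
splitting `S_L(x) = S_M(x) + S_{L-M}(2^M x)` (4.4), the substitution (4.5), the bound by the maximum
of the `2^M`-periodisation (4.6)–(4.7), and the fact (4.10)–(4.11) that this periodisation of
`e^{ξ S_M}` is maximal at `x = 0` because the cosine expansion of `e^{ξ S_M}` has nonnegative
coefficients. This file proves the finite, directly usable form of all this (without the limit
`ψ(ξ)` of part (a)):

* `cosSum` (`S_L`), `cosSum_add` ((4.4)), `cosSum_add_nat` (period `1`), `cosSum_le` (`S_L ≤ L`);
* `IsNonnegCosPoly` (finite nonnegative combinations of `cos(2π ν x)`, `ν ∈ ℤ`) with its closure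
  properties, `sum_cos_shift_le` (complete character sums over `ℤ/Q`) and
  `IsNonnegCosPoly.sum_shift_le`: `∑_{k<Q} f((u+k)/Q) ≤ ∑_{k<Q} f(k/Q)` ((4.11));
  `sum_exp_cosSum_shift_le`: the same for `e^{ξ S_M}`, `ξ ≥ 0`, by the exponential series ((4.10));
* `expMoment`, `discMoment` (`E_L`, `E*_M`), `expMoment_add_le`: **`E_{M+L}(ξ) ≤ E*_M(ξ) E_L(ξ)`**
  ((4.5)–(4.7) with (4.10)), `expMoment_le_pow_mul`: `E_{nM+r} ≤ (E*_M)ⁿ E_r` (Theorem 2(b) in finite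
  form), `expMoment_le_pow_mul_exp`: `E_L ≤ (E*_M)^{⌊L/M⌋} e^{ξ(L mod M)}`;
* `measureReal_cosSum_ge_le` (Chernoff: `|{x ∈ [0,1] : S_L(x) ≥ t}| ≤ e^{-ξt} E_L(ξ)`) and
  `measureReal_cosSum_ge_mul_le`: `|{S_L ≥ dL}| ≤ e^{-ξdL} (E*_M)^{⌊L/M⌋} e^{ξ(L mod M)}` — the scheme of
  §7 ((7.1): any `d > (log E*_M(ξ) + cM)/(ξM)` makes this `< e^{-cL}` up to a constant), whose
  remaining input is ONE numerical upper bound for a finite sum `E*_M(ξ)` (Pintz–Ruzsa compute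
  `ψ` to 15 digits by the polynomial method of §§5–6 instead; Corollaries 1–2 there).

What is NOT here: Theorem 2(a) (existence of `ψ(ξ) = lim L⁻¹ log E_L(ξ)`), part (c) and Lemma 4
(the passage from `S_L = Re G_L` to `|G_L|`, needed for the set `𝓔 = {|G_L| > (1-η)L}` of
Corollaries 1–2 and of (10.6) in the proof of `Literature.NumberTheory.Sieve.goldbach_linnik`), the
transfer-matrix method of §5 (Lemmas 5–7) and all numerics.

## References

* J. Pintz, I. Z. Ruzsa, *On Linnik's approximation to Goldbach's problem, I*, Acta Arith. 109
  (2003) 169–194, §3, §4 Theorem 2 with (4.4)–(4.12), §7 (7.1). [PintzRuzsa2003]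
-/

noncomputable section

open Finset Filter MeasureTheory Real
open scoped Topology

namespace Literature.NumberTheory.Sieve

namespace PintzRuzsa2003

/-! ### The cosine sum `S_L` -/

/-- `S_L(x) = ∑_{j=0}^{L-1} cos(2π 2^j x)`, the real part of `G_L(x) = ∑_{j<L} e(2^j x)`
(Pintz–Ruzsa I §4, `g = 2`). [cite: PintzRuzsa2003, §4 (definition of S_L)] -/
def cosSum (L : ℕ) (x : ℝ) : ℝ := ∑ j ∈ Finset.range L, Real.cos (2 * π * 2 ^ j * x)

/-- `S_L` is continuous. [folklore] -/
theorem continuous_cosSum (L : ℕ) : Continuous (cosSum L) := by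
  unfold cosSum
  exact continuous_finsetSum _ fun j _ => Real.continuous_cos.comp (continuous_const.mul continuous_id)

/-- `|S_L(x)| ≤ L`, in the form `S_L(x) ≤ L`. [folklore] -/
theorem cosSum_le (L : ℕ) (x : ℝ) : cosSum L x ≤ L := by
  unfold cosSum
  calc ∑ j ∈ Finset.range L, Real.cos (2 * π * 2 ^ j * x) ≤ ∑ j ∈ Finset.range L, (1 : ℝ) :=
        Finset.sum_le_sum fun j _ => Real.cos_le_one _
    _ = L := by simp

/-- `S_L` has period `1`: `S_L(x + n) = S_L(x)` for `n ∈ ℕ`. [folklore] -/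
theorem cosSum_add_nat (L : ℕ) (x : ℝ) (n : ℕ) : cosSum L (x + n) = cosSum L x := by
  unfold cosSum
  refine Finset.sum_congr rfl fun j _ => ?_
  have : 2 * π * 2 ^ j * (x + n) = 2 * π * 2 ^ j * x + ((2 ^ j * n : ℕ) : ℕ) * (2 * π) := by
    push_cast; ring
  rw [this, Real.cos_add_nat_mul_two_pi]

/-- Splitting: `S_{M+L}(x) = S_M(x) + S_L(2^M x)`. [cite: PintzRuzsa2003, §4 (proof of Thm 2, (4.4))] -/
theorem cosSum_add (M L : ℕ) (x : ℝ) : cosSum (M + L) x = cosSum M x + cosSum L (2 ^ M * x) := by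
  unfold cosSum
  rw [Finset.sum_range_add]
  congr 1
  refine Finset.sum_congr rfl fun j _ => ?_
  rw [pow_add]
  ring_nf

/-! ### Nonnegative cosine polynomials and the averaging inequality (4.10)–(4.11) -/

/-- `f` is a finite combination of `cos(2π ν x)`, `ν ∈ ℤ`, with nonnegative coefficients (the
structure "the expansion has nonnegative coefficients" used in the proof of (4.10)). [cite: PintzRuzsa2003, §4 (4.11)] -/
def IsNonnegCosPoly (f : ℝ → ℝ) : Prop :=
  ∃ (ι : Type) (_ : Fintype ι) (w : ι → ℝ) (ν : ι → ℤ),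
    (∀ i, 0 ≤ w i) ∧ ∀ x, f x = ∑ i, w i * Real.cos (2 * π * ν i * x)

namespace IsNonnegCosPoly

/-- A single cosine `cos(2π ν x)`. [folklore] -/
theorem cos (ν : ℤ) : IsNonnegCosPoly fun x => Real.cos (2 * π * ν * x) :=
  ⟨Unit, inferInstance, fun _ => 1, fun _ => ν, fun _ => zero_le_one, fun x => by simp⟩

/-- A nonnegative constant. [folklore] -/
theorem const {c : ℝ} (hc : 0 ≤ c) : IsNonnegCosPoly fun _ => c :=
  ⟨Unit, inferInstance, fun _ => c, fun _ => 0, fun _ => hc, fun x => by simp⟩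

/-- Closure under addition. [folklore] -/
theorem add {f g : ℝ → ℝ} (hf : IsNonnegCosPoly f) (hg : IsNonnegCosPoly g) :
    IsNonnegCosPoly fun x => f x + g x := by
  obtain ⟨ι, _, w, ν, hw, hfx⟩ := hf
  obtain ⟨κ, _, w', ν', hw', hgx⟩ := hg
  refine ⟨ι ⊕ κ, inferInstance, Sum.elim w w', Sum.elim ν ν', ?_, fun x => ?_⟩
  · rintro (i | k)
    · exact hw i
    · exact hw' k
  · dsimp only
    rw [Fintype.sum_sum_type, hfx, hgx]
    simp

/-- Closure under nonnegative scalars. [folklore] -/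
theorem smul {f : ℝ → ℝ} (hf : IsNonnegCosPoly f) {c : ℝ} (hc : 0 ≤ c) :
    IsNonnegCosPoly fun x => c * f x := by
  obtain ⟨ι, _, w, ν, hw, hfx⟩ := hf
  refine ⟨ι, inferInstance, fun i => c * w i, ν, fun i => mul_nonneg hc (hw i), fun x => ?_⟩
  dsimp only
  rw [hfx, Finset.mul_sum]
  refine Finset.sum_congr rfl fun i _ => ?_
  ring

/-- Closure under multiplication (`cos a cos b = (cos(a+b) + cos(a-b))/2`). [folklore] -/
theorem mul {f g : ℝ → ℝ} (hf : IsNonnegCosPoly f) (hg : IsNonnegCosPoly g) :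
    IsNonnegCosPoly fun x => f x * g x := by
  obtain ⟨ι, _, w, ν, hw, hfx⟩ := hf
  obtain ⟨κ, _, w', ν', hw', hgx⟩ := hg
  refine ⟨ι × κ × Bool, inferInstance, fun p => w p.1 * w' p.2.1 / 2,
    fun p => if p.2.2 then ν p.1 + ν' p.2.1 else ν p.1 - ν' p.2.1, fun p => ?_, fun x => ?_⟩
  · exact div_nonneg (mul_nonneg (hw _) (hw' _)) (by norm_num)
  · dsimp only
    rw [hfx, hgx, Finset.sum_mul_sum, Fintype.sum_prod_type]
    refine Finset.sum_congr rfl fun i _ => ?_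
    rw [Fintype.sum_prod_type]
    refine Finset.sum_congr rfl fun k _ => ?_
    rw [Fintype.sum_bool]
    simp only [Bool.false_eq_true, if_true, if_false]
    push_cast
    rw [show 2 * π * ((ν i : ℝ) + ν' k) * x = 2 * π * ν i * x + 2 * π * ν' k * x by ring,
      show 2 * π * ((ν i : ℝ) - ν' k) * x = 2 * π * ν i * x - 2 * π * ν' k * x by ring,
      Real.cos_add, Real.cos_sub]
    ring

/-- Closure under powers. [folklore] -/
theorem pow {f : ℝ → ℝ} (hf : IsNonnegCosPoly f) (n : ℕ) : IsNonnegCosPoly fun x => f x ^ n := by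
  induction n with
  | zero => simpa using const zero_le_one
  | succ n ih =>
      have := ih.mul hf
      simpa [pow_succ] using this

/-- Closure under finite sums. [folklore] -/
theorem sum {α : Type*} (s : Finset α) {f : α → ℝ → ℝ} (hf : ∀ a ∈ s, IsNonnegCosPoly (f a)) :
    IsNonnegCosPoly fun x => ∑ a ∈ s, f a x := by
  classical
  induction s using Finset.induction_on with
  | empty => simpa using const le_rfl
  | insert a s ha ih =>
      have h := (hf a (Finset.mem_insert_self a s)).add (ih fun b hb => hf b (Finset.mem_insert_of_mem hb))
      simpa [Finset.sum_insert ha] using h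

end IsNonnegCosPoly

/-- `S_M` is a nonnegative cosine polynomial. [folklore] -/
theorem isNonnegCosPoly_cosSum (M : ℕ) : IsNonnegCosPoly (cosSum M) := by
  have h := IsNonnegCosPoly.sum (Finset.range M) (f := fun j x => Real.cos (2 * π * ((2 ^ j : ℕ) : ℤ) * x))
    (fun j _ => IsNonnegCosPoly.cos _)
  have e : cosSum M = fun x => ∑ j ∈ Finset.range M, Real.cos (2 * π * ((2 ^ j : ℕ) : ℤ) * x) := by
    funext x
    unfold cosSum
    refine Finset.sum_congr rfl fun j _ => ?_
    push_cast
    ring_nf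
  rw [e]
  exact h

/-! ### Sums of a cosine over `k/Q`, `k < Q` -/

/-- `cos t = Re e^{it}` packaged for `t = 2π ν y`: `cos(2π ν y) = Re (exp(2π i ν y))`. [folklore] -/
theorem cos_eq_re_exp (t : ℝ) : Real.cos t = (Complex.exp (t * Complex.I)).re := by
  rw [Complex.exp_ofReal_mul_I_re]

/-- **Complete sums of a character over `ℤ/Qℤ`**: for `Q ≥ 1`, `ν ∈ ℤ` and real `u`,
`∑_{k<Q} cos(2π ν (u + k)/Q) ≤ ∑_{k<Q} cos(2π ν k/Q)` — both sides vanish unless `Q ∣ ν`, when the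
right side is `Q` and the left side is `Q cos(2π ν u/Q)`. [folklore] -/
theorem sum_cos_shift_le (Q : ℕ) (hQ : 0 < Q) (ν : ℤ) (u : ℝ) :
    ∑ k ∈ Finset.range Q, Real.cos (2 * π * ν * ((u + k) / Q)) ≤
      ∑ k ∈ Finset.range Q, Real.cos (2 * π * ν * ((k : ℝ) / Q)) := by
  have hQ0 : (Q : ℝ) ≠ 0 := by exact_mod_cast hQ.ne'
  by_cases hdvd : (Q : ℤ) ∣ ν
  · -- `ν = Q m`: every term on the right is `1`, on the left `cos(2π m u)`
    obtain ⟨m, rfl⟩ := hdvd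
    have hR : ∀ k ∈ Finset.range Q, Real.cos (2 * π * ((Q : ℤ) * m : ℤ) * ((k : ℝ) / Q)) = 1 := by
      intro k _
      have : 2 * π * ((Q : ℤ) * m : ℤ) * ((k : ℝ) / Q) = ((m * k : ℤ) : ℤ) * (2 * π) := by
        push_cast; field_simp
      rw [this, Real.cos_int_mul_two_pi]
    have hL : ∀ k ∈ Finset.range Q, Real.cos (2 * π * ((Q : ℤ) * m : ℤ) * ((u + k) / Q)) =
        Real.cos (2 * π * m * u) := by
      intro k _
      have : 2 * π * ((Q : ℤ) * m : ℤ) * ((u + k) / Q) = 2 * π * m * u + ((m * k : ℤ) : ℤ) * (2 * π) := by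
        push_cast; field_simp
      rw [this, Real.cos_add_int_mul_two_pi]
    rw [Finset.sum_congr rfl hR, Finset.sum_congr rfl hL, Finset.sum_const, Finset.sum_const,
      Finset.card_range, nsmul_eq_mul, nsmul_eq_mul, mul_one]
    exact mul_le_of_le_one_right (Nat.cast_nonneg Q) (Real.cos_le_one _)
  · -- `Q ∤ ν`: both sums vanish (geometric sum of a nontrivial `Q`-th root of unity)
    have hQ0' : (Q : ℂ) ≠ 0 := by exact_mod_cast hQ.ne'
    set z : ℂ := Complex.exp (2 * π * ν / Q * Complex.I) with hz
    have hz1 : z ≠ 1 := by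
      intro h1
      rw [hz, Complex.exp_eq_one_iff] at h1
      obtain ⟨n, hn⟩ := h1
      apply hdvd
      refine ⟨n, ?_⟩
      have hπ : (2 * π * Complex.I : ℂ) ≠ 0 := by simp [Real.pi_ne_zero, Complex.I_ne_zero]
      have h2 : ((ν : ℂ) / Q) * (2 * π * Complex.I) = n * (2 * π * Complex.I) := by
        rw [← hn]; ring
      have h3 : (ν : ℂ) / Q = n := mul_right_cancel₀ hπ h2
      rw [div_eq_iff hQ0'] at h3
      have : ((ν : ℤ) : ℂ) = ((Q * n : ℤ) : ℂ) := by rw [h3]; push_cast; ring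
      exact_mod_cast this
    have hzQ : z ^ Q = 1 := by
      rw [hz, ← Complex.exp_nat_mul, Complex.exp_eq_one_iff]
      refine ⟨ν, ?_⟩
      field_simp
    have hgeom : ∑ k ∈ Finset.range Q, z ^ k = 0 := by
      rw [geom_sum_eq hz1, hzQ, sub_self, zero_div]
    -- each cosine is the real part of `w z^k`
    have hterm : ∀ (c : ℝ) (k : ℕ), Real.cos (2 * π * ν * ((c + k) / Q)) =
        (Complex.exp (2 * π * ν * (c / Q) * Complex.I) * z ^ k).re := by
      intro c k
      rw [hz, ← Complex.exp_nat_mul, ← Complex.exp_add, cos_eq_re_exp]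
      congr 2
      push_cast
      field_simp
    have hsum : ∀ c : ℝ, ∑ k ∈ Finset.range Q, Real.cos (2 * π * ν * ((c + k) / Q)) = 0 := by
      intro c
      calc ∑ k ∈ Finset.range Q, Real.cos (2 * π * ν * ((c + k) / Q))
          = ∑ k ∈ Finset.range Q, (Complex.exp (2 * π * ν * (c / Q) * Complex.I) * z ^ k).re :=
            Finset.sum_congr rfl fun k _ => hterm c k
        _ = (Complex.exp (2 * π * ν * (c / Q) * Complex.I) * ∑ k ∈ Finset.range Q, z ^ k).re := by
            rw [Finset.mul_sum, Complex.re_sum]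
        _ = 0 := by rw [hgeom, mul_zero, Complex.zero_re]
    have h0 := hsum 0
    simp only [zero_add] at h0
    rw [hsum u, h0]

/-- **The averaging inequality (4.10)–(4.11)**: for a nonnegative cosine polynomial `f`, every `Q ≥ 1`
and every real `u`, `∑_{k<Q} f((u + k)/Q) ≤ ∑_{k<Q} f(k/Q)` ("this function assumes its maximum at
`x = 0`"). [cite: PintzRuzsa2003, §4 (4.10)–(4.11)] -/
theorem IsNonnegCosPoly.sum_shift_le {f : ℝ → ℝ} (hf : IsNonnegCosPoly f) (Q : ℕ) (hQ : 0 < Q) (u : ℝ) :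
    ∑ k ∈ Finset.range Q, f ((u + k) / Q) ≤ ∑ k ∈ Finset.range Q, f ((k : ℝ) / Q) := by
  obtain ⟨ι, _, w, ν, hw, hfx⟩ := hf
  simp_rw [hfx]
  rw [Finset.sum_comm, Finset.sum_comm (s := Finset.range Q)]
  refine Finset.sum_le_sum fun i _ => ?_
  rw [← Finset.mul_sum, ← Finset.mul_sum]
  exact mul_le_mul_of_nonneg_left (sum_cos_shift_le Q hQ (ν i) u) (hw i)

/-! ### Passing to `exp(ξ S_M)` -/

/-- The exponential series along `ℕ`: `∑_{j<J} t^j/j! → e^t`. [folklore] -/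
theorem tendsto_sum_range_pow_div_factorial (t : ℝ) :
    Tendsto (fun J : ℕ => ∑ j ∈ Finset.range J, t ^ j / (Nat.factorial j)) atTop (𝓝 (Real.exp t)) := by
  have h : HasSum (fun j : ℕ => t ^ j / (Nat.factorial j)) (Real.exp t) := by
    rw [Real.exp_eq_exp_ℝ]
    exact NormedSpace.expSeries_div_hasSum_exp t
  exact h.tendsto_sum_nat

/-- **(4.10) for `e^{ξ S_M}`**: for `ξ ≥ 0`, `Q ≥ 1` and every `u`,
`∑_{k<Q} e^{ξ S_M((u+k)/Q)} ≤ ∑_{k<Q} e^{ξ S_M(k/Q)}` (the partial sums of the exponential series are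
nonnegative cosine polynomials, then pass to the limit). [cite: PintzRuzsa2003, §4 (4.10)] -/
theorem sum_exp_cosSum_shift_le {ξ : ℝ} (hξ : 0 ≤ ξ) (M Q : ℕ) (hQ : 0 < Q) (u : ℝ) :
    ∑ k ∈ Finset.range Q, Real.exp (ξ * cosSum M ((u + k) / Q)) ≤
      ∑ k ∈ Finset.range Q, Real.exp (ξ * cosSum M ((k : ℝ) / Q)) := by
  -- partial sums `T_J(x) = ∑_{j<J} (ξ S_M(x))^j / j!`
  set T : ℕ → ℝ → ℝ := fun J x => ∑ j ∈ Finset.range J, (ξ * cosSum M x) ^ j / (Nat.factorial j) with hT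
  have hTpoly : ∀ J, IsNonnegCosPoly (T J) := by
    intro J
    have h := IsNonnegCosPoly.sum (Finset.range J)
      (f := fun j x => (ξ ^ j / (Nat.factorial j)) * cosSum M x ^ j)
      (fun j _ => ((isNonnegCosPoly_cosSum M).pow j).smul (by positivity))
    have e : T J = fun x => ∑ j ∈ Finset.range J, (ξ ^ j / (Nat.factorial j)) * cosSum M x ^ j := by
      funext x
      simp only [hT]
      refine Finset.sum_congr rfl fun j _ => ?_
      rw [mul_pow]; ring
    rw [e]; exact h
  have hineq : ∀ J, ∑ k ∈ Finset.range Q, T J ((u + k) / Q) ≤ ∑ k ∈ Finset.range Q, T J ((k : ℝ) / Q) :=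
    fun J => (hTpoly J).sum_shift_le Q hQ u
  have hlim : ∀ x, Tendsto (fun J => T J x) atTop (𝓝 (Real.exp (ξ * cosSum M x))) := fun x => by
    simp only [hT]
    exact tendsto_sum_range_pow_div_factorial _
  have hL := tendsto_finsetSum (Finset.range Q) fun k _ => hlim ((u + k) / Q)
  have hR := tendsto_finsetSum (Finset.range Q) fun k _ => hlim ((k : ℝ) / Q)
  exact le_of_tendsto_of_tendsto' hL hR hineq

/-! ### The exponential moments `E_L(ξ)` and `E*_M(ξ)`; Theorem 2(b) -/

/-- `E_L(ξ) = ∫₀¹ e^{ξ S_L(x)} dx` (Pintz–Ruzsa I §4). [cite: PintzRuzsa2003, §4 Thm 2] -/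
def expMoment (ξ : ℝ) (L : ℕ) : ℝ := ∫ x in (0 : ℝ)..1, Real.exp (ξ * cosSum L x)

/-- `E*_M(ξ) = 2^{-M} ∑_{k<2^M} e^{ξ S_M(k 2^{-M})}`, the discrete moment of (4.2) and (4.8)–(4.10).
[cite: PintzRuzsa2003, §4 (4.2)] -/
def discMoment (ξ : ℝ) (M : ℕ) : ℝ :=
  ((2 : ℝ) ^ M)⁻¹ * ∑ k ∈ Finset.range (2 ^ M), Real.exp (ξ * cosSum M ((k : ℝ) / 2 ^ M))

/-- The integrand `e^{ξ S_L}` is continuous. [folklore] -/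
theorem continuous_exp_cosSum (ξ : ℝ) (L : ℕ) : Continuous fun x => Real.exp (ξ * cosSum L x) :=
  Real.continuous_exp.comp (continuous_const.mul (continuous_cosSum L))

/-- `E_L(ξ) ≥ 0`. [folklore] -/
theorem expMoment_nonneg (ξ : ℝ) (L : ℕ) : 0 ≤ expMoment ξ L :=
  intervalIntegral.integral_nonneg zero_le_one fun _ _ => (Real.exp_pos _).le

/-- `E*_M(ξ) ≥ 0`. [folklore] -/
theorem discMoment_nonneg (ξ : ℝ) (M : ℕ) : 0 ≤ discMoment ξ M := by
  unfold discMoment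
  exact mul_nonneg (by positivity) (Finset.sum_nonneg fun k _ => (Real.exp_pos _).le)

/-- `E_0(ξ) = 1`. [folklore] -/
theorem expMoment_zero_len (ξ : ℝ) : expMoment ξ 0 = 1 := by
  simp [expMoment, cosSum]

/-- The trivial bound `E_L(ξ) ≤ e^{ξL}` for `ξ ≥ 0` (`S_L ≤ L`). [folklore] -/
theorem expMoment_le_exp {ξ : ℝ} (hξ : 0 ≤ ξ) (L : ℕ) : expMoment ξ L ≤ Real.exp (ξ * L) := by
  unfold expMoment
  calc ∫ x in (0 : ℝ)..1, Real.exp (ξ * cosSum L x) ≤ ∫ x in (0 : ℝ)..1, Real.exp (ξ * L) := by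
        refine intervalIntegral.integral_mono_on zero_le_one
          ((continuous_exp_cosSum ξ L).intervalIntegrable _ _) (continuous_const.intervalIntegrable _ _)
          fun x _ => Real.exp_le_exp.mpr (mul_le_mul_of_nonneg_left (cosSum_le L x) hξ)
    _ = Real.exp (ξ * L) := by simp

/-- **(4.5) and (4.10): sub-multiplicativity against the discrete moment.** For `ξ ≥ 0`,
`E_{M+L}(ξ) ≤ E*_M(ξ) · E_L(ξ)`: split `[0,1]` into the `2^M` intervals `[k 2^{-M}, (k+1) 2^{-M}]`,
substitute `x = (u + k) 2^{-M}` (then `S_{M+L}(x) = S_M(x) + S_L(u + k) = S_M(x) + S_L(u)`), and bound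
`∑_k e^{ξ S_M((u+k)/2^M)} ≤ 2^M E*_M(ξ)` by `sum_exp_cosSum_shift_le`.
[cite: PintzRuzsa2003, §4 (4.4)–(4.7), (4.10)] -/
theorem expMoment_add_le {ξ : ℝ} (hξ : 0 ≤ ξ) (M L : ℕ) :
    expMoment ξ (M + L) ≤ discMoment ξ M * expMoment ξ L := by
  set Q : ℕ := 2 ^ M with hQ
  have hQpos : 0 < Q := by positivity
  have hQr : ((Q : ℕ) : ℝ) = (2 : ℝ) ^ M := by rw [hQ]; push_cast; ring
  have hQ0 : ((Q : ℕ) : ℝ) ≠ 0 := by positivity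
  -- the integrand and its factorisation
  set h : ℝ → ℝ := fun x => Real.exp (ξ * cosSum (M + L) x) with hh
  have hcont : Continuous h := continuous_exp_cosSum ξ (M + L)
  have hfac : ∀ (u : ℝ) (k : ℕ), h (u / Q + k / Q) =
      Real.exp (ξ * cosSum M ((u + k) / Q)) * Real.exp (ξ * cosSum L u) := by
    intro u k
    simp only [hh]
    rw [cosSum_add, ← Real.exp_add]
    congr 1
    have e1 : u / Q + k / Q = (u + k) / Q := by ring
    have e2 : (2 : ℝ) ^ M * ((u + k) / Q) = u + k := by rw [← hQr]; field_simp
    rw [e1, e2, cosSum_add_nat]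
    ring
  -- Step A: split `[0,1]`
  have hsplit : ∫ x in (0 : ℝ)..1, h x = ∑ k ∈ Finset.range Q, ∫ x in ((k : ℝ) / Q)..(((k + 1 : ℕ) : ℝ) / Q), h x := by
    rw [intervalIntegral.sum_integral_adjacent_intervals (a := fun k : ℕ => (k : ℝ) / Q)
      (fun k _ => hcont.intervalIntegrable _ _)]
    simp [hQ0]
  -- Step B: substitute on each piece
  have hpiece : ∀ k : ℕ, ∫ x in ((k : ℝ) / Q)..(((k + 1 : ℕ) : ℝ) / Q), h x =
      (Q : ℝ)⁻¹ * ∫ u in (0 : ℝ)..1, Real.exp (ξ * cosSum M ((u + k) / Q)) * Real.exp (ξ * cosSum L u) := by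
    intro k
    have hsub := intervalIntegral.integral_comp_div_add (a := 0) (b := 1) h hQ0 ((k : ℝ) / Q)
    rw [zero_div, zero_add, show (1 : ℝ) / Q + k / Q = ((k + 1 : ℕ) : ℝ) / Q by push_cast; ring,
      smul_eq_mul] at hsub
    have h2 : ∫ x in ((k : ℝ) / Q)..(((k + 1 : ℕ) : ℝ) / Q), h x = (Q : ℝ)⁻¹ * ∫ x in (0 : ℝ)..1, h (x / Q + k / Q) := by
      rw [hsub, ← mul_assoc, inv_mul_cancel₀ hQ0, one_mul]
    rw [h2]
    congr 1
    exact intervalIntegral.integral_congr fun u _ => hfac u k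
  -- Step C: collect and bound pointwise
  have hint : ∀ k ∈ Finset.range Q, IntervalIntegrable
      (fun u => Real.exp (ξ * cosSum M ((u + k) / Q)) * Real.exp (ξ * cosSum L u)) volume 0 1 := by
    intro k _
    refine Continuous.intervalIntegrable ?_ _ _
    exact ((Real.continuous_exp.comp (continuous_const.mul ((continuous_cosSum M).comp
      ((continuous_id.add continuous_const).div_const _)))).mul (continuous_exp_cosSum ξ L))
  have hsum_cont : Continuous fun u => (∑ k ∈ Finset.range Q, Real.exp (ξ * cosSum M ((u + k) / Q))) := by
    refine continuous_finsetSum _ fun k _ => ?_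
    exact Real.continuous_exp.comp (continuous_const.mul ((continuous_cosSum M).comp
      ((continuous_id.add continuous_const).div_const _)))
  calc expMoment ξ (M + L) = ∫ x in (0 : ℝ)..1, h x := rfl
    _ = ∑ k ∈ Finset.range Q, (Q : ℝ)⁻¹ * ∫ u in (0 : ℝ)..1,
          Real.exp (ξ * cosSum M ((u + k) / Q)) * Real.exp (ξ * cosSum L u) := by
        rw [hsplit]; exact Finset.sum_congr rfl fun k _ => hpiece k
    _ = (Q : ℝ)⁻¹ * ∫ u in (0 : ℝ)..1,
          (∑ k ∈ Finset.range Q, Real.exp (ξ * cosSum M ((u + k) / Q))) * Real.exp (ξ * cosSum L u) := by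
        rw [← Finset.mul_sum, ← intervalIntegral.integral_finsetSum hint]
        congr 1
        refine intervalIntegral.integral_congr fun u _ => ?_
        simp only [Finset.sum_mul]
    _ ≤ (Q : ℝ)⁻¹ * ∫ u in (0 : ℝ)..1,
          (∑ k ∈ Finset.range Q, Real.exp (ξ * cosSum M ((k : ℝ) / Q))) * Real.exp (ξ * cosSum L u) := by
        refine mul_le_mul_of_nonneg_left ?_ (by positivity)
        refine intervalIntegral.integral_mono_on zero_le_one
          ((hsum_cont.mul (continuous_exp_cosSum ξ L)).intervalIntegrable _ _)
          ((continuous_const.mul (continuous_exp_cosSum ξ L)).intervalIntegrable _ _) fun u _ => ?_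
        exact mul_le_mul_of_nonneg_right (sum_exp_cosSum_shift_le hξ M Q hQpos u) (Real.exp_pos _).le
    _ = discMoment ξ M * expMoment ξ L := by
        rw [intervalIntegral.integral_const_mul, discMoment, expMoment, ← mul_assoc]
        congr 2
        · rw [hQr]
        · refine Finset.sum_congr (by rw [hQ]) fun k _ => ?_
          rw [hQr]

/-- **Pintz–Ruzsa I, Theorem 2(b) in finite form**: for `ξ ≥ 0` and all `M, n, r`,
`E_{nM + r}(ξ) ≤ E*_M(ξ)ⁿ E_r(ξ)` (induction on `expMoment_add_le`; with (a) this is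
`e^{Lψ(ξ)} ≤ E*_M(ξ)^{L/M}`, the right-hand inequality of (4.2)). [cite: PintzRuzsa2003, §4 Thm 2(b) (4.2)] -/
theorem expMoment_le_pow_mul {ξ : ℝ} (hξ : 0 ≤ ξ) (M n r : ℕ) :
    expMoment ξ (n * M + r) ≤ discMoment ξ M ^ n * expMoment ξ r := by
  induction n with
  | zero => simp
  | succ n ih =>
      have hD := discMoment_nonneg ξ M
      calc expMoment ξ ((n + 1) * M + r) = expMoment ξ (M + (n * M + r)) := by ring_nf
        _ ≤ discMoment ξ M * expMoment ξ (n * M + r) := expMoment_add_le hξ M _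
        _ ≤ discMoment ξ M * (discMoment ξ M ^ n * expMoment ξ r) := mul_le_mul_of_nonneg_left ih hD
        _ = discMoment ξ M ^ (n + 1) * expMoment ξ r := by ring

/-- The usable bound for every `L`: `E_L(ξ) ≤ E*_M(ξ)^{⌊L/M⌋} e^{ξ (L mod M)}` (`ξ ≥ 0`, `M ≥ 1`).
[cite: PintzRuzsa2003, §4 Thm 2(b) (4.2)] -/
theorem expMoment_le_pow_mul_exp {ξ : ℝ} (hξ : 0 ≤ ξ) (M L : ℕ) :
    expMoment ξ L ≤ discMoment ξ M ^ (L / M) * Real.exp (ξ * (L % M : ℕ)) := by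
  have h := expMoment_le_pow_mul hξ M (L / M) (L % M)
  rw [Nat.div_add_mod' L M] at h
  exact h.trans (mul_le_mul_of_nonneg_left (expMoment_le_exp hξ _) (pow_nonneg (discMoment_nonneg ξ M) _))

/-! ### Large deviations of `S_L` (Chernoff) -/

/-- **Large deviations of `S_L`**: for `ξ ≥ 0` and real `t`,
`|{x ∈ [0,1] : S_L(x) ≥ t}| ≤ e^{-ξ t} E_L(ξ)` (Markov's inequality for `e^{ξ S_L}`); with
`expMoment_le_pow_mul_exp` this is the scheme of §7: `μ(|S_L| > dL) < e^{(ψ(ξ) - ξd + o(1))L}`.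
[cite: PintzRuzsa2003, §7 (first paragraph)] -/
theorem measureReal_cosSum_ge_le {ξ : ℝ} (hξ : 0 ≤ ξ) (L : ℕ) (t : ℝ) :
    volume.real {x ∈ Set.Icc (0 : ℝ) 1 | t ≤ cosSum L x} ≤ Real.exp (-(ξ * t)) * expMoment ξ L := by
  set μ : Measure ℝ := volume.restrict (Set.Icc (0 : ℝ) 1) with hμ
  haveI : IsFiniteMeasure μ := by rw [hμ]; infer_instance
  set f : ℝ → ℝ := fun x => Real.exp (ξ * cosSum L x) with hf
  have hf0 : 0 ≤ᵐ[μ] f := Eventually.of_forall fun x => (Real.exp_pos _).le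
  have hfint : Integrable f μ := by
    rw [hμ]
    exact (continuous_exp_cosSum ξ L).continuousOn.integrableOn_compact isCompact_Icc
  have hmarkov := mul_meas_ge_le_integral_of_nonneg hf0 hfint (Real.exp (ξ * t))
  -- the integral is `E_L(ξ)`
  have hint : ∫ x, f x ∂μ = expMoment ξ L := by
    rw [hμ, expMoment, intervalIntegral.integral_of_le zero_le_one, integral_Icc_eq_integral_Ioc]
  rw [hint] at hmarkov
  -- the superlevel set of `S_L` sits inside that of `f`
  have hmeas : MeasurableSet {x : ℝ | t ≤ cosSum L x} :=
    (isClosed_le continuous_const (continuous_cosSum L)).measurableSet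
  have hsub : {x : ℝ | t ≤ cosSum L x} ⊆ {x | Real.exp (ξ * t) ≤ f x} := fun x hx =>
    Real.exp_le_exp.mpr (mul_le_mul_of_nonneg_left hx hξ)
  have hset : volume.real {x ∈ Set.Icc (0 : ℝ) 1 | t ≤ cosSum L x} = μ.real {x : ℝ | t ≤ cosSum L x} := by
    rw [hμ, measureReal_restrict_apply hmeas]
    congr 1
    ext x
    simp [and_comm]
  rw [hset]
  have hmono : μ.real {x : ℝ | t ≤ cosSum L x} ≤ μ.real {x | Real.exp (ξ * t) ≤ f x} :=
    measureReal_mono hsub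
  have hexp : 0 < Real.exp (ξ * t) := Real.exp_pos _
  calc μ.real {x : ℝ | t ≤ cosSum L x} ≤ μ.real {x | Real.exp (ξ * t) ≤ f x} := hmono
    _ ≤ expMoment ξ L / Real.exp (ξ * t) := by rw [le_div_iff₀ hexp, mul_comm]; exact hmarkov
    _ = Real.exp (-(ξ * t)) * expMoment ξ L := by rw [Real.exp_neg, div_eq_inv_mul]

/-- **The large-deviation scheme of §7, in finite form**: for `ξ ≥ 0`, `M ≥ 1`, every `L` and `d`,
`|{x ∈ [0,1] : S_L(x) ≥ dL}| ≤ e^{ξM} · exp(-L (ξ d - (log E*_M(ξ))/M))` whenever `E*_M(ξ) ≥ 1`;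
stated as `≤ e^{-ξ d L} E*_M(ξ)^{⌊L/M⌋} e^{ξ (L mod M)}`. A numerical upper bound for one value
`E*_M(ξ)` therefore yields an exponentially small measure as soon as `ξ d > (log E*_M(ξ))/M`
((7.1): `d > inf_ξ (ψ(ξ) + c)/ξ`). [cite: PintzRuzsa2003, §7 (7.1)] -/
theorem measureReal_cosSum_ge_mul_le {ξ : ℝ} (hξ : 0 ≤ ξ) (M L : ℕ) (d : ℝ) :
    volume.real {x ∈ Set.Icc (0 : ℝ) 1 | d * L ≤ cosSum L x} ≤
      Real.exp (-(ξ * (d * L))) * (discMoment ξ M ^ (L / M) * Real.exp (ξ * (L % M : ℕ))) :=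
  (measureReal_cosSum_ge_le hξ L (d * L)).trans
    (mul_le_mul_of_nonneg_left (expMoment_le_pow_mul_exp hξ M L) (Real.exp_pos _).le)

end PintzRuzsa2003

end Literature.NumberTheory.Sieve

end
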